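import Mathlib

/-!
# Theorem B from Theorem A — the parameter inequality

Pure real-analysis bookkeeping for the kernel derivation of the report's Theorem B
(`W(p) ≤ max{100·g·a₁a₂, 250} + 4`) from Bugeaud–Laurent's Théorème 1 with `γ = 1/2`
(Theorem A): with the parameter choice `L = 5`, `K = ⌊20G⌋ + 1`, `R₁ - 1 ≤ √(5g a₂/a₁)`, …,
hypothesis (2♭) of Theorem A holds as soon as `log p ≥ 100 log 2` and `G = g a₁ a₂ ≥ 5/2`.
All constants are verified in the kernel (no floating point): `e > 2.7`, `exp(3/2) < 4.49`,
`exp(1.1) > 2.84`, `log x ≤ 2√x/e`.  (solo-ABC-informed, paper §2.3.)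
-/

namespace Summit.ABC.ABC.Theorems

open Finset Real

/-- `log x ≤ 0.741 · √x` for `x > 0` (from `log(√x/e) ≤ √x/e - 1` and `e > 2.7`). -/
theorem soloInformed_log_le_sqrt (x : ℝ) (hx : 0 < x) : Real.log x ≤ 0.741 * Real.sqrt x := by
  have hs : 0 < Real.sqrt x := Real.sqrt_pos.mpr hx
  have he : 0 < Real.exp 1 := Real.exp_pos 1
  have h := Real.log_le_sub_one_of_pos (show 0 < Real.sqrt x / Real.exp 1 by positivity)
  rw [Real.log_div hs.ne' he.ne', Real.log_exp, Real.log_sqrt hx.le] at h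
  have he27 : (2.7 : ℝ) < Real.exp 1 := lt_trans (by norm_num) Real.exp_one_gt_d9
  have h2 : Real.sqrt x / Real.exp 1 ≤ Real.sqrt x / 2.7 :=
    div_le_div_of_nonneg_left hs.le (by norm_num) he27.le
  have h3 : Real.sqrt x / 2.7 ≤ 0.741 / 2 * Real.sqrt x := by
    rw [div_le_iff₀ (by norm_num)]; nlinarith
  linarith

/-- `exp(3/2) < 4.49`. -/
theorem soloInformed_exp_three_halves_lt : Real.exp (3 / 2) < 4.49 := by
  have h1 : Real.exp (3 / 2) = Real.exp 1 * Real.exp (1 / 2) := by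
    rw [← Real.exp_add]; norm_num
  have h2 : Real.exp (1 / 2) ^ 2 = Real.exp 1 := by
    rw [← Real.exp_nat_mul]; norm_num
  have he := Real.exp_one_lt_d9
  have h3 : Real.exp (1 / 2) < 1.6488 := by
    by_contra h
    push Not at h
    have : (1.6488 : ℝ) ^ 2 ≤ Real.exp (1 / 2) ^ 2 := by
      exact pow_le_pow_left₀ (by norm_num) h 2
    rw [h2] at this
    linarith
  rw [h1]
  have h4 : 0 < Real.exp (1 / 2) := Real.exp_pos _
  calc Real.exp 1 * Real.exp (1 / 2) ≤ 2.7182818286 * 1.6488 := by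
        apply mul_le_mul he.le h3.le h4.le (by norm_num)
    _ < 4.49 := by norm_num

/-- `2.84 < exp(1.1)` (from `1 + x + x²/2 ≤ exp x` at `x = 0.1375` and `exp(1.1) = exp(0.1375)^8`). -/
theorem soloInformed_lt_exp_one_pt_one : (2.84 : ℝ) < Real.exp 1.1 := by
  have h1 : Real.exp 1.1 = Real.exp 0.1375 ^ 8 := by
    rw [← Real.exp_nat_mul]; norm_num
  have h2 : (1.1469 : ℝ) ≤ Real.exp 0.1375 := by
    have := Real.quadratic_le_exp_of_nonneg (show (0 : ℝ) ≤ 0.1375 by norm_num)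
    linarith
  have h3 : (1.1469 : ℝ) ^ 8 ≤ Real.exp 0.1375 ^ 8 := pow_le_pow_left₀ (by norm_num) h2 8
  rw [h1]
  exact lt_of_lt_of_le (by norm_num) h3

/-- `(1 + √(K-1))·√K ≤ 1.16·(K-1)` for `K ≥ 51`. -/
theorem soloInformed_psi_le (K : ℝ) (hK : 51 ≤ K) :
    (1 + Real.sqrt (K - 1)) * Real.sqrt K ≤ 1.16 * (K - 1) := by
  set t := Real.sqrt (K - 1) with ht
  have ht0 : 0 ≤ t := Real.sqrt_nonneg _
  have ht2 : t ^ 2 = K - 1 := by rw [ht, Real.sq_sqrt (by linarith)]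
  have ht7 : 7 ≤ t := by
    rw [ht]
    exact Real.le_sqrt_of_sq_le (by linarith)  -- 49 ≤ K - 1
  have hK' : K = t ^ 2 + 1 := by linarith
  have hsK : Real.sqrt K ≤ t + 1 / 14 := by
    rw [Real.sqrt_le_iff]
    constructor
    · positivity
    · rw [hK']; nlinarith
  calc (1 + t) * Real.sqrt K ≤ (1 + t) * (t + 1 / 14) :=
        mul_le_mul_of_nonneg_left hsK (by positivity)
    _ ≤ 1.16 * (K - 1) := by rw [← ht2]; nlinarith [sq_nonneg (t - 7)]

/-- `a · √(c/a) = √(c·a)` for `a > 0`, `c ≥ 0`. -/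
theorem soloInformed_mul_sqrt_div (a c : ℝ) (ha : 0 < a) (hc : 0 ≤ c) :
    a * Real.sqrt (c / a) = Real.sqrt (c * a) := by
  have h0 : 0 ≤ a * Real.sqrt (c / a) := by positivity
  rw [← Real.sqrt_sq h0, mul_pow, Real.sq_sqrt (by positivity)]
  congr 1; field_simp

set_option maxHeartbeats 800000 in
/-- **The parameter inequality.** With `Lp = log p ≥ 100 log 2`, `a₁, a₂ > 0`, `aᵢ·Lp ≥ 1`,
`g ≥ 1`, `G = g a₁ a₂ ≥ 5/2`, `e > 0` with `log e ≤ Lp`, `K = ⌊20G⌋ + 1`,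
`Rᵢ, Sᵢ` as in the text and the factorial factor `F ≤ 1.09·e^{3/2}/(K-1)`, hypothesis (2♭) of
Theorem A holds for `L = 5`, `b₁ = b₂ = e`, `h₁ = a₁ Lp`, `h₂ = a₂ Lp`. -/
theorem soloInformed_thmB_params {Lp a₁ a₂ g e F : ℝ} {K R₁ R₂ S₁ S₂ : ℕ}
    (hLp : 100 * Real.log 2 ≤ Lp) (ha₁ : 0 < a₁) (ha₂ : 0 < a₂)
    (ha₁' : 1 ≤ a₁ * Lp) (ha₂' : 1 ≤ a₂ * Lp) (hg : 1 ≤ g)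
    (hG : 5 / 2 ≤ g * a₁ * a₂) (he : 0 < e) (heLp : Real.log e ≤ Lp)
    (hK : K = ⌊20 * (g * a₁ * a₂)⌋₊ + 1)
    (hR₁ : (R₁ : ℝ) - 1 ≤ Real.sqrt (5 * g * a₂ / a₁))
    (hS₁ : (S₁ : ℝ) - 1 ≤ Real.sqrt (5 * g * a₁ / a₂))
    (hR₂ : (R₂ : ℝ) - 1 ≤ Real.sqrt (5 * g * ((K : ℝ) - 1) * a₂ / a₁))
    (hS₂ : (S₂ : ℝ) - 1 ≤ Real.sqrt (5 * g * ((K : ℝ) - 1) * a₁ / a₂))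
    (h1R₁ : 1 ≤ R₁) (h1R₂ : 1 ≤ R₂) (h1S₁ : 1 ≤ S₁) (h1S₂ : 1 ≤ S₂) (hRS : 3 ≤ R₂ + S₂)
    (hF0 : 0 < F) (hF : F ≤ Real.exp (3 / 2) * 1.09 / ((K : ℝ) - 1)) :
    3 * Real.log ((K : ℝ) * 5)
      + ((K : ℝ) - 1) * Real.log ((((R₁ : ℝ) + R₂ - 2) * e + ((S₁ : ℝ) + S₂ - 2) * e) / 2 * F)
      + (5 : ℝ) / 2 * (((R₁ : ℝ) + R₂ - 2) * (a₁ * Lp) + ((S₁ : ℝ) + S₂ - 2) * (a₂ * Lp))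
      < (K : ℝ) * (5 - 1) * Lp := by
  -- Notation and basic positivity
  set G := g * a₁ * a₂ with hGdef
  have hlog2 := Real.log_two_gt_d9
  have hLp69 : (68.89 : ℝ) ≤ Lp := by linarith
  have hLp0 : 0 < Lp := by linarith
  have hG0 : 0 < G := by linarith
  have hg0 : 0 < g := by linarith
  -- K
  have hK20 : 20 * G < K := by
    rw [hK]; push_cast; exact Nat.lt_floor_add_one _
  have hKle : (K : ℝ) ≤ 20 * G + 1 := by
    rw [hK]; push_cast; linarith [Nat.floor_le (show 0 ≤ 20 * G by positivity)]
  have hK51 : (51 : ℝ) ≤ K := by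
    rw [hK]; push_cast
    have : (50 : ℕ) ≤ ⌊20 * G⌋₊ := Nat.le_floor (by push_cast; linarith)
    have : (50 : ℝ) ≤ (⌊20 * G⌋₊ : ℝ) := by exact_mod_cast this
    linarith
  have hK1 : (0 : ℝ) < (K : ℝ) - 1 := by linarith
  -- square roots: s = √Lp, q = √(5G), t = √(K-1)
  set s := Real.sqrt Lp with hs
  have hs2 : s ^ 2 = Lp := Real.sq_sqrt hLp0.le
  have hs83 : 8.3 ≤ s := Real.le_sqrt_of_sq_le (by linarith)
  set q := Real.sqrt (5 * G) with hq
  have hq2 : q ^ 2 = 5 * G := Real.sq_sqrt (by positivity)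
  have hq35 : 3.5 ≤ q := Real.le_sqrt_of_sq_le (by linarith)
  have hq0 : 0 < q := by linarith
  set t := Real.sqrt ((K : ℝ) - 1) with htdef
  have ht0 : 0 ≤ t := Real.sqrt_nonneg _
  have ht2 : t ^ 2 = (K : ℝ) - 1 := Real.sq_sqrt hK1.le
  -- the four radius bounds, multiplied through
  have hx₁ : a₁ * Real.sqrt (5 * g * a₂ / a₁) = q := by
    rw [soloInformed_mul_sqrt_div _ _ ha₁ (by positivity), hq]
    congr 1; rw [hGdef]; ring
  have hx₂ : a₂ * Real.sqrt (5 * g * a₁ / a₂) = q := by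
    rw [soloInformed_mul_sqrt_div _ _ ha₂ (by positivity), hq]
    congr 1; rw [hGdef]; ring
  have hx₃ : a₁ * Real.sqrt (5 * g * ((K : ℝ) - 1) * a₂ / a₁) = t * q := by
    rw [soloInformed_mul_sqrt_div _ _ ha₁ (by positivity), hq, htdef, ← Real.sqrt_mul hK1.le]
    congr 1; rw [hGdef]; ring
  have hx₄ : a₂ * Real.sqrt (5 * g * ((K : ℝ) - 1) * a₁ / a₂) = t * q := by
    rw [soloInformed_mul_sqrt_div _ _ ha₂ (by positivity), hq, htdef, ← Real.sqrt_mul hK1.le]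
    congr 1; rw [hGdef]; ring
  have hRa : ((R₁ : ℝ) + R₂ - 2) * a₁ ≤ (1 + t) * q := by
    have h1 := mul_le_mul_of_nonneg_left hR₁ ha₁.le
    have h2 := mul_le_mul_of_nonneg_left hR₂ ha₁.le
    rw [hx₁] at h1; rw [hx₃] at h2
    have : ((R₁ : ℝ) + R₂ - 2) * a₁ = a₁ * ((R₁ : ℝ) - 1) + a₁ * ((R₂ : ℝ) - 1) := by ring
    linarith
  have hSa : ((S₁ : ℝ) + S₂ - 2) * a₂ ≤ (1 + t) * q := by
    have h1 := mul_le_mul_of_nonneg_left hS₁ ha₂.le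
    have h2 := mul_le_mul_of_nonneg_left hS₂ ha₂.le
    rw [hx₂] at h1; rw [hx₄] at h2
    have : ((S₁ : ℝ) + S₂ - 2) * a₂ = a₂ * ((S₁ : ℝ) - 1) + a₂ * ((S₂ : ℝ) - 1) := by ring
    linarith
  -- t ≤ √(20 G) = 2 q   (K - 1 ≤ 20 G)
  have ht2q : t ≤ 2 * q := by
    have h1 : t ≤ Real.sqrt (20 * G) := Real.sqrt_le_sqrt (by linarith)
    have h2 : Real.sqrt (20 * G) = 2 * q := by
      rw [show (20 : ℝ) * G = 4 * (5 * G) by ring, Real.sqrt_mul (by norm_num), hq]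
      congr 1
      rw [show (4 : ℝ) = 2 ^ 2 by norm_num, Real.sqrt_sq (by norm_num)]
    linarith
  -- height term ≤ 5 Lp q + 10 q² Lp
  have hH : (5 : ℝ) / 2 * (((R₁ : ℝ) + R₂ - 2) * (a₁ * Lp) + ((S₁ : ℝ) + S₂ - 2) * (a₂ * Lp))
      ≤ 5 * Lp * q + 10 * q ^ 2 * Lp := by
    have h1 := mul_le_mul_of_nonneg_right hRa hLp0.le
    have h2 := mul_le_mul_of_nonneg_right hSa hLp0.le
    have h3 := mul_le_mul_of_nonneg_right ht2q (by positivity : (0 : ℝ) ≤ q * Lp)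
    have e1 : ((R₁ : ℝ) + R₂ - 2) * (a₁ * Lp) = ((R₁ : ℝ) + R₂ - 2) * a₁ * Lp := by ring
    have e2 : ((S₁ : ℝ) + S₂ - 2) * (a₂ * Lp) = ((S₁ : ℝ) + S₂ - 2) * a₂ * Lp := by ring
    have e3 : (1 + t) * q * Lp = q * Lp + t * (q * Lp) := by ring
    have e4 : 2 * q * (q * Lp) = 2 * q ^ 2 * Lp := by ring
    rw [e1, e2]
    linarith
  -- the sum of the radii: Σ (Rᵢ - 1) ≤ (1+t) q (1/a₁ + 1/a₂) ≤ (1+t) q · 2 Lp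
  have htq0 : (0 : ℝ) ≤ (1 + t) * q := by positivity
  have hR0 : (0 : ℝ) ≤ (R₁ : ℝ) + R₂ - 2 := by
    have : (1:ℝ) ≤ R₁ := by exact_mod_cast h1R₁
    have : (1:ℝ) ≤ R₂ := by exact_mod_cast h1R₂
    linarith
  have hS0 : (0 : ℝ) ≤ (S₁ : ℝ) + S₂ - 2 := by
    have : (1:ℝ) ≤ S₁ := by exact_mod_cast h1S₁
    have : (1:ℝ) ≤ S₂ := by exact_mod_cast h1S₂
    linarith
  have hsum : ((R₁ : ℝ) + R₂ - 2) + ((S₁ : ℝ) + S₂ - 2) ≤ (1 + t) * q * (2 * Lp) := by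
    have h1 : ((R₁ : ℝ) + R₂ - 2) ≤ (1 + t) * q * Lp := by
      have h := mul_le_mul_of_nonneg_right hRa hLp0.le
      have hprod := mul_nonneg hR0 (by linarith : (0 : ℝ) ≤ a₁ * Lp - 1)
      have e : ((R₁ : ℝ) + R₂ - 2) * (a₁ * Lp - 1) = ((R₁ : ℝ) + R₂ - 2) * a₁ * Lp - ((R₁ : ℝ) + R₂ - 2) := by ring
      linarith
    have h2 : ((S₁ : ℝ) + S₂ - 2) ≤ (1 + t) * q * Lp := by
      have h := mul_le_mul_of_nonneg_right hSa hLp0.le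
      have hprod := mul_nonneg hS0 (by linarith : (0 : ℝ) ≤ a₂ * Lp - 1)
      have e : ((S₁ : ℝ) + S₂ - 2) * (a₂ * Lp - 1) = ((S₁ : ℝ) + S₂ - 2) * a₂ * Lp - ((S₁ : ℝ) + S₂ - 2) := by ring
      linarith
    linarith
  -- b = e · (Σ/2 · F), and Σ/2·F ≤ 2.84 Lp
  have hRSpos : (0 : ℝ) < ((R₁ : ℝ) + R₂ - 2) + ((S₁ : ℝ) + S₂ - 2) := by
    have : (3 : ℝ) ≤ (R₂ : ℝ) + S₂ := by exact_mod_cast hRS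
    have h1 : (1 : ℝ) ≤ R₁ := by exact_mod_cast h1R₁
    have h2 : (1 : ℝ) ≤ S₁ := by exact_mod_cast h1S₁
    linarith
  have hb_eq : (((R₁ : ℝ) + R₂ - 2) * e + ((S₁ : ℝ) + S₂ - 2) * e) / 2 * F
      = e * ((((R₁ : ℝ) + R₂ - 2) + ((S₁ : ℝ) + S₂ - 2)) / 2 * F) := by ring
  have hqK : 2 * q ≤ Real.sqrt K := by
    apply Real.le_sqrt_of_sq_le
    have : (2 * q) ^ 2 = 4 * (5 * G) := by rw [mul_pow, hq2]; ring
    linarith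
  have hpsi := soloInformed_psi_le (K : ℝ) hK51
  rw [← htdef] at hpsi
  have hexp := soloInformed_exp_three_halves_lt
  have hinner : ((((R₁ : ℝ) + R₂ - 2) + ((S₁ : ℝ) + S₂ - 2)) / 2 * F) ≤ Lp * 2.84 := by
    have h1 : (((R₁ : ℝ) + R₂ - 2) + ((S₁ : ℝ) + S₂ - 2)) / 2 * F ≤ (1 + t) * q * (2 * Lp) / 2 * F :=
      mul_le_mul_of_nonneg_right (div_le_div_of_nonneg_right hsum (by norm_num)) hF0.le
    have e1 : (1 + t) * q * (2 * Lp) / 2 * F = (1 + t) * q * Lp * F := by ring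
    rw [e1] at h1
    have h2 : (1 + t) * q ≤ 0.58 * ((K : ℝ) - 1) := by
      have : (1 + t) * (2 * q) ≤ (1 + t) * Real.sqrt K :=
        mul_le_mul_of_nonneg_left hqK (by positivity)
      linarith
    have h3 : (1 + t) * q * Lp * F
        ≤ 0.58 * ((K : ℝ) - 1) * Lp * (Real.exp (3 / 2) * 1.09 / ((K : ℝ) - 1)) := by
      apply mul_le_mul _ hF hF0.le (by positivity)
      exact mul_le_mul_of_nonneg_right h2 hLp0.le
    have h4 : 0.58 * ((K : ℝ) - 1) * Lp * (Real.exp (3 / 2) * 1.09 / ((K : ℝ) - 1))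
        = 0.58 * 1.09 * (Real.exp (3 / 2) * Lp) := by field_simp
    rw [h4] at h3
    have h5 : Real.exp (3 / 2) * Lp ≤ 4.49 * Lp := mul_le_mul_of_nonneg_right hexp.le hLp0.le
    linarith
  have hlogb : Real.log ((((R₁ : ℝ) + R₂ - 2) * e + ((S₁ : ℝ) + S₂ - 2) * e) / 2 * F)
      ≤ Lp + 0.741 * s + 1.1 := by
    rw [hb_eq, Real.log_mul he.ne' (by positivity)]
    have h1 : Real.log ((((R₁ : ℝ) + R₂ - 2) + ((S₁ : ℝ) + S₂ - 2)) / 2 * F)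
        ≤ Real.log (Lp * 2.84) := Real.log_le_log (by positivity) hinner
    rw [Real.log_mul hLp0.ne' (by norm_num)] at h1
    have h2 : Real.log 2.84 ≤ 1.1 := by
      rw [Real.log_le_iff_le_exp (by norm_num)]
      exact soloInformed_lt_exp_one_pt_one.le
    have h3 := soloInformed_log_le_sqrt Lp hLp0
    linarith
  -- 3 log (5K) ≤ 10.05 q
  have hlogK : 3 * Real.log ((K : ℝ) * 5) ≤ 10.05 * q := by
    have h1 := soloInformed_log_le_sqrt ((K : ℝ) * 5) (by positivity)
    have h2 : Real.sqrt ((K : ℝ) * 5) ≤ 4.52 * q := by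
      rw [Real.sqrt_le_iff]
      refine ⟨by positivity, ?_⟩
      have : (4.52 * q) ^ 2 = 20.4304 * (5 * G) := by rw [mul_pow, hq2]; ring
      linarith
    linarith
  -- (K-1) log b ≤ (K-1)(Lp + 0.741 s + 1.1)
  have hB0 : 0 < Lp + 0.741 * s + 1.1 := by positivity
  have hKlogb : ((K : ℝ) - 1)
        * Real.log ((((R₁ : ℝ) + R₂ - 2) * e + ((S₁ : ℝ) + S₂ - 2) * e) / 2 * F)
      ≤ ((K : ℝ) - 1) * (Lp + 0.741 * s + 1.1) := mul_le_mul_of_nonneg_left hlogb hK1.le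
  -- final polynomial inequality in q, s, Lp = s², with K > 4 q²
  have hK4q : 4 * q ^ 2 < K := by rw [hq2]; linarith
  have hsLp : 8.3 * s ≤ Lp := by
    rw [← hs2, sq]; exact mul_le_mul_of_nonneg_right hs83 (by linarith)
  have hA0 : 0 ≤ 2 * Lp - 2.964 * s - 4.4 := by linarith
  have hpoly : 0 ≤ q * (2 * Lp - 2.964 * s - 4.4) - 5 * Lp - 10.05 := by
    have h := mul_nonneg (sub_nonneg.2 hq35) hA0
    have e : (q - 3.5) * (2 * Lp - 2.964 * s - 4.4)
        = q * (2 * Lp - 2.964 * s - 4.4) - 3.5 * (2 * Lp - 2.964 * s - 4.4) := by ring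
    linarith
  have hpos3 : 0 < 3 * Lp - 0.741 * s - 1.1 := by linarith
  have h1 : 4 * q ^ 2 * (3 * Lp - 0.741 * s - 1.1) ≤ (K : ℝ) * (3 * Lp - 0.741 * s - 1.1) :=
    mul_le_mul_of_nonneg_right hK4q.le hpos3.le
  have h2 : 0 ≤ q * (q * (2 * Lp - 2.964 * s - 4.4) - 5 * Lp - 10.05) := mul_nonneg hq0.le hpoly
  linarith [h1, h2, hH, hKlogb, hlogK, hB0]

end Summit.ABC.ABC.Theorems
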